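import Summits.KontsevichZagierPeriods.KontsevichZagierPeriods.Theorems.RootDecompZetaThreeFrontierWordMovesPole

/-!
# Route RootDecompZetaThreeFrontier — the two MOVE FACTS under item 28709 — part 2/2 (`…WordMoves`): `divergenceLEThree` (non-admissible simplex words of weight ≤ 3 have coefficient 0) and `dualityThree` (`[Δ₃, q·ω₀ω₁ω₁] ≡ [Δ₃, q·ω₀ω₀ω₁]` by ONE change of variables), with EXACTLY the one-line signatures of `g9/bc/RouteVocab.lean`

`divergenceLEThree`: a simplex word representation `[Δ_{w+1}, q·∏ ω_{εᵢ}(tᵢ)]`, `w + 1 ≤ 3`, whose word starts with `ω₁` (`ε 0 = true`) or ends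
with `ω₀` (`ε last = false`) has `q = 0` — by contradiction: the integrand would be absolutely integrable on `Δ_{w+1}`, but a.e. section in the
offending coordinate is `C/t` on `(0, x_last)` or `C/(1-t)` on `(x₀, 1)` with `C ≠ 0` (part 1's templates + pole test); weight 1 directly.
`dualityThree`: the order-reversing involution `tᵢ ↦ 1 - t₂₋ᵢ` of `Δ₃` is semialgebraic, affine with `|det| = 1`, injective and onto `Δ₃`, and
pulls `q/(u₀u₁(1-u₂))` back to `q/(t₀(1-t₁)(1-t₂))`; ONE instance of `KZ.changeOfVariablesRel`.  These are the hypotheses `DivergenceLEThree`,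
`DualityThree` of WordLayer's kernel edge `genusZeroThreeNormalForm_of_moves' : GZNormalFormWThree′ → DivergenceLEThree → DualityThree′ →
GenusZeroThreeNormalForm` (item 28709); the tree twins `MzvKernelInKZ.Negative.Divergence.eq_zero_of_not_adm` / `Negative.cDual3_mem_relations`
live in modules unbuilt on the farm today, hence the self-contained proofs.  [Kontsevich–Zagier 2001 §1.2 rules (2),(3); folklore]  Standard axioms, 0 sorry.
-/

noncomputable section

set_option linter.dupNamespace false

open Set MeasureTheory MvPolynomial
open Literature.NumberTheory.Transcendental
open Literature.ModelTheory.ExponentialFields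

namespace Summit.KontsevichZagierPeriods.KontsevichZagierPeriods.Theorems.RootDecompZetaThreeFrontierWordMoves

/-! ## Word integrands and their sections -/

/-- a word letter never vanishes inside `(0,1)` -/
theorem letter_ne_zero (e : Bool) {y : ℝ} (h0 : 0 < y) (h1 : y < 1) :
    (if e then 1 / (1 - y) else 1 / y : ℝ) ≠ 0 := by
  cases e
  · simpa using h0.ne'
  · have : (1 : ℝ) - y ≠ 0 := by linarith
    simpa using this

/-- the word integrand -/
def wordF {n : ℕ} (ε : Fin n → Bool) (q : ℚ) (t : Fin n → ℝ) : ℝ :=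
  (q : ℝ) * ∏ i, if ε i then 1 / (1 - t i) else 1 / t i

/-- Splitting the LAST letter off a word integrand. [folklore] -/
theorem wordF_snoc {N : ℕ} (ε : Fin (N + 1) → Bool) (q : ℚ) (x : Fin N → ℝ) (t : ℝ) :
    wordF ε q (Fin.snoc x t) = ((q : ℝ) * ∏ i : Fin N, if ε (Fin.castSucc i) then 1 / (1 - x i) else 1 / x i) *
      (if ε (Fin.last N) then 1 / (1 - t) else 1 / t) := by
  simp only [wordF, Fin.prod_univ_castSucc, Fin.snoc_castSucc, Fin.snoc_last, mul_assoc]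

/-- Splitting the FIRST letter off a word integrand. [folklore] -/
theorem wordF_cons {N : ℕ} (ε : Fin (N + 1) → Bool) (q : ℚ) (x : Fin N → ℝ) (t : ℝ) :
    wordF ε q (Fin.cons t x) = ((q : ℝ) * ∏ i : Fin N, if ε (Fin.succ i) then 1 / (1 - x i) else 1 / x i) *
      (if ε 0 then 1 / (1 - t) else 1 / t) := by
  simp only [wordF, Fin.prod_univ_succ, Fin.cons_zero, Fin.cons_succ]
  ring

/-- the base factor is nonzero on `Δ_N` -/
theorem base_ne_zero {N : ℕ} (δ : Fin N → Bool) {q : ℚ} (hq : q ≠ 0) {x : Fin N → ℝ}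
    (hx : x ∈ KZ.openOrderedSimplex N) :
    ((q : ℝ) * ∏ i : Fin N, if δ i then 1 / (1 - x i) else 1 / x i) ≠ 0 := by
  refine mul_ne_zero (by exact_mod_cast hq) (Finset.prod_ne_zero_iff.2 fun i _ => ?_)
  exact letter_ne_zero (δ i) (hx.1 i) (hx.2.1 i)

/-! ## Divergence: weights 2, 3 by sections, weight 1 directly -/

/-- **no non-admissible word of weight 2 is absolutely integrable on `Δ₂`** -/
theorem not_integrableOn_wordF_two (ε : Fin 2 → Bool) {q : ℚ} (hq : q ≠ 0)
    (hε : ε 0 = true ∨ ε (Fin.last 1) = false) :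
    ¬ IntegrableOn (wordF ε q) (KZ.openOrderedSimplex 2) := by
  by_cases hlast : ε (Fin.last 1) = false
  · -- pole `C/t` at `t → 0` on every last-coordinate section
    refine not_integrableOn_of_snoc_pole (wordF ε q) (fun x => x 0)
      (fun x => (q : ℝ) * ∏ i : Fin 1, if ε (Fin.castSucc i) then 1 / (1 - x i) else 1 / x i)
      (fun x hx => snoc_section_two hx) (fun x hx => ?_) (fun x hx t ht => ?_)
      (fun x hx => base_ne_zero _ hq hx) simplex_one_nonempty
    · obtain ⟨h0, h1⟩ := (mem_simplex_one_iff x).1 hx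
      exact ⟨h0, h1.le⟩
    · rw [wordF_snoc, hlast]
      simp only [Bool.false_eq_true, ↓reduceIte, pow_one, mul_one_div]
  · -- then `ε 0 = true`: pole `C/(1-t)` at `t → 1` on every first-coordinate section
    have h0 : ε 0 = true := by
      rcases hε with h | h
      · exact h
      · exact absurd h hlast
    refine not_integrableOn_of_cons_pole (wordF ε q) (fun x => x 0)
      (fun x => (q : ℝ) * ∏ i : Fin 1, if ε (Fin.succ i) then 1 / (1 - x i) else 1 / x i)
      (fun x hx => cons_section_two hx) (fun x hx => ?_) (fun x hx t ht => ?_)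
      (fun x hx => base_ne_zero _ hq hx) simplex_one_nonempty
    · obtain ⟨hx0, hx1⟩ := (mem_simplex_one_iff x).1 hx
      exact ⟨hx0.le, hx1⟩
    · rw [wordF_cons, h0]
      simp only [↓reduceIte, pow_one, mul_one_div]

/-- **no non-admissible word of weight 3 is absolutely integrable on `Δ₃`** -/
theorem not_integrableOn_wordF_three (ε : Fin 3 → Bool) {q : ℚ} (hq : q ≠ 0)
    (hε : ε 0 = true ∨ ε (Fin.last 2) = false) :
    ¬ IntegrableOn (wordF ε q) (KZ.openOrderedSimplex 3) := by
  by_cases hlast : ε (Fin.last 2) = false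
  · refine not_integrableOn_of_snoc_pole (wordF ε q) (fun x => x 1)
      (fun x => (q : ℝ) * ∏ i : Fin 2, if ε (Fin.castSucc i) then 1 / (1 - x i) else 1 / x i)
      (fun x hx => snoc_section_three hx) (fun x hx => ?_) (fun x hx t ht => ?_)
      (fun x hx => base_ne_zero _ hq hx) simplex_two_nonempty
    · obtain ⟨h1, h10, h0⟩ := (mem_simplex_two_iff x).1 hx
      exact ⟨h1, (h10.trans h0).le⟩
    · rw [wordF_snoc, hlast]
      simp only [Bool.false_eq_true, ↓reduceIte, pow_one, mul_one_div]
  · have h0 : ε 0 = true := by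
      rcases hε with h | h
      · exact h
      · exact absurd h hlast
    refine not_integrableOn_of_cons_pole (wordF ε q) (fun x => x 0)
      (fun x => (q : ℝ) * ∏ i : Fin 2, if ε (Fin.succ i) then 1 / (1 - x i) else 1 / x i)
      (fun x hx => cons_section_three hx) (fun x hx => ?_) (fun x hx t ht => ?_)
      (fun x hx => base_ne_zero _ hq hx) simplex_two_nonempty
    · obtain ⟨h1, h10, hx0⟩ := (mem_simplex_two_iff x).1 hx
      exact ⟨(h1.trans h10).le, hx0⟩
    · rw [wordF_cons, h0]
      simp only [↓reduceIte, pow_one, mul_one_div]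

/-- **`[Δ₁, q·ω_ε]` is a representation only if `q = 0`**: neither `q/y` nor `q/(1-y)` is integrable
on `(0,1)` — the `w = 0` slice of `DivergenceLEThree`, by the same pole test. -/
theorem divergence_weight_one (ε : Fin 1 → Bool) (q : ℚ) (s : KZ.IntegralRep 1)
    (hd : s.domain = {t | (∀ i, 0 < t i) ∧ (∀ i, t i < 1) ∧ StrictAnti t})
    (hi : EqOn s.integrand (fun t => (q : ℝ) * ∏ i, if ε i then 1 / (1 - t i) else 1 / t i)
      s.domain) : q = 0 := by
  by_contra hq
  have hq' : (0:ℝ) < |(q:ℝ)| := abs_pos.2 (Rat.cast_ne_zero.2 hq)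
  have key : ¬ IntegrableOn (fun y : ℝ => (fun _ : ℝ => (q : ℝ)) y / y ^ 1) (Ioo 0 1) :=
    not_integrableOn_pole hq' one_pos le_rfl le_rfl (fun _ _ => le_rfl)
  apply key
  cases h : ε 0
  · -- `ω₀ = dy/y`
    have hiF : EqOn s.integrand (fun t => (fun y : ℝ => (fun _ : ℝ => (q : ℝ)) y / y ^ 1) (t 0))
        s.domain := by
      intro t ht; rw [hi ht]; simp [h, div_eq_mul_inv]
    exact integrableOn_real_of_rep s _ hd hiF
  · -- `ω₁ = dy/(1-y)`: reflect
    have hiF : EqOn s.integrand (fun t => (fun y : ℝ => (q : ℝ) / (1 - y)) (t 0)) s.domain := by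
      intro t ht; rw [hi ht]; simp [h, div_eq_mul_inv]
    refine (integrableOn_reflect (integrableOn_real_of_rep s (fun y : ℝ => (q : ℝ) / (1 - y)) hd
      hiF)).congr_fun (fun y _ => ?_) measurableSet_Ioo
    simp only [sub_sub_cancel, pow_one]

/-- **`DivergenceLEThree`** (the one-line route-vocabulary signature of `g9/bc/RouteVocab.lean`, verbatim): a simplex word representation of
weight `w + 1 ≤ 3` whose word starts with `ω₁` or ends with `ω₀` has coefficient `0`. [Kontsevich–Zagier 2001 §1.2; folklore] -/
theorem divergenceLEThree : ∀ (w : ℕ) (ε : Fin (w + 1) → Bool) (q : ℚ) (s : Literature.NumberTheory.Transcendental.KZ.IntegralRep (w + 1)), w + 1 ≤ 3 → (ε 0 = true ∨ ε (Fin.last w) = false) → s.domain = {t | (∀ i, 0 < t i) ∧ (∀ i, t i < 1) ∧ StrictAnti t} → Set.EqOn s.integrand (fun t => (q : ℝ) * ∏ i, if ε i then 1 / (1 - t i) else 1 / t i) s.domain → q = 0 := by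
  intro w ε q s hw hε hd hi
  by_contra hq
  have hw2 : w ≤ 2 := by omega
  interval_cases w
  · exact hq (divergence_weight_one ε q s hd hi)
  · have hF : IntegrableOn (wordF ε q) (KZ.openOrderedSimplex 2) := by
      have h := s.integrableOn
      rw [hd] at h
      exact h.congr_fun (fun z hz => hi (by rw [hd]; exact hz)) (KZ.measurableSet_openOrderedSimplex 2)
    exact not_integrableOn_wordF_two ε hq hε hF
  · have hF : IntegrableOn (wordF ε q) (KZ.openOrderedSimplex 3) := by
      have h := s.integrableOn
      rw [hd] at h
      exact h.congr_fun (fun z hz => hi (by rw [hd]; exact hz)) (KZ.measurableSet_openOrderedSimplex 3)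
    exact not_integrableOn_wordF_three ε hq hε hF

/-! ## Duality at weight 3: the involution `tᵢ ↦ 1 - t₂₋ᵢ` of `Δ₃` -/

/-- the duality involution of `Δ₃` and its (constant) derivative -/
def duΦ (z : Fin 3 → ℝ) : Fin 3 → ℝ := ![1 - z 2, 1 - z 1, 1 - z 0]

/-- The linear part of `duΦ`: `w ↦ (i ↦ -w (rev i))`. [folklore] -/
def duL : (Fin 3 → ℝ) →L[ℝ] (Fin 3 → ℝ) :=
  -(ContinuousLinearMap.pi fun i : Fin 3 =>
    ContinuousLinearMap.proj (R := ℝ) (φ := fun _ : Fin 3 => ℝ) (Fin.rev i))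

/-- `Fin.rev 0 = 2` in `Fin 3`. [folklore] -/
private theorem rev3_zero : Fin.rev (0 : Fin 3) = 2 := by decide

/-- `Fin.rev 1 = 1` in `Fin 3`. [folklore] -/
private theorem rev3_one : Fin.rev (1 : Fin 3) = 1 := by decide

/-- `Fin.rev 2 = 0` in `Fin 3`. [folklore] -/
private theorem rev3_two : Fin.rev (2 : Fin 3) = 0 := by decide

/-- `duL w i = -w (rev i)`. [folklore] -/
theorem duL_apply (w : Fin 3 → ℝ) (i : Fin 3) : duL w i = -w (Fin.rev i) := by
  simp [duL]

/-- `duΦ z 0 = 1 - z 2`. [folklore] -/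
theorem duΦ_zero (z : Fin 3 → ℝ) : duΦ z 0 = 1 - z 2 := by simp [duΦ]

/-- `duΦ z 1 = 1 - z 1`. [folklore] -/
theorem duΦ_one (z : Fin 3 → ℝ) : duΦ z 1 = 1 - z 1 := by simp [duΦ]

/-- `duΦ z 2 = 1 - z 0`. [folklore] -/
theorem duΦ_two (z : Fin 3 → ℝ) : duΦ z 2 = 1 - z 0 := by simp [duΦ]

/-- `duΦ` is an involution. [folklore] -/
theorem duΦ_duΦ (z : Fin 3 → ℝ) : duΦ (duΦ z) = z := by
  funext i
  fin_cases i <;> simp [duΦ_zero, duΦ_one, duΦ_two]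

/-- `duΦ = 1 + duL` (affine). [folklore] -/
theorem duΦ_eq (z : Fin 3 → ℝ) : duΦ z = (fun _ => (1 : ℝ)) + duL z := by
  funext i
  fin_cases i
  · simp [duΦ_zero, duL_apply, sub_eq_add_neg]
  · simp [duΦ_one, duL_apply, rev3_one, sub_eq_add_neg]
  · simp [duΦ_two, duL_apply, rev3_two, sub_eq_add_neg]

/-- `duL` is an involution. [folklore] -/
theorem duL_duL (w : Fin 3 → ℝ) : duL (duL w) = w := by
  funext i
  fin_cases i <;> simp [duL_apply, rev3_one, rev3_two]

/-- `|det duL| = 1` (from `duL ∘ duL = id`). [folklore] -/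
theorem abs_det_duL : |duL.det| = 1 := by
  have hcomp : (duL : (Fin 3 → ℝ) →ₗ[ℝ] (Fin 3 → ℝ)) ∘ₗ (duL : (Fin 3 → ℝ) →ₗ[ℝ] (Fin 3 → ℝ)) =
      LinearMap.id := by
    apply LinearMap.ext
    intro w
    simp [duL_duL]
  have h := congrArg LinearMap.det hcomp
  rw [LinearMap.det_comp, LinearMap.det_id] at h
  have h2 : |LinearMap.det (duL : (Fin 3 → ℝ) →ₗ[ℝ] (Fin 3 → ℝ))| ^ 2 = 1 := by
    rw [sq_abs, sq, h]
  exact (pow_eq_one_iff_of_nonneg (abs_nonneg _) two_ne_zero).1 h2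

/-- `duΦ` maps `Δ₃` into `Δ₃`. [folklore] -/
theorem mem_simplex_three_duΦ {z : Fin 3 → ℝ} (hz : z ∈ KZ.openOrderedSimplex 3) :
    duΦ z ∈ KZ.openOrderedSimplex 3 := by
  rw [mem_simplex_three_iff] at hz ⊢
  rw [duΦ_zero, duΦ_one, duΦ_two]
  obtain ⟨h2, h21, h10, h0⟩ := hz
  exact ⟨by linarith, by linarith, by linarith, by linarith⟩

/-- `duΦ  Δ₃ = Δ₃`. [folklore] -/
theorem image_duΦ : duΦ '' KZ.openOrderedSimplex 3 = KZ.openOrderedSimplex 3 := by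
  ext u
  constructor
  · rintro ⟨z, hz, rfl⟩
    exact mem_simplex_three_duΦ hz
  · intro hu
    exact ⟨duΦ u, mem_simplex_three_duΦ hu, duΦ_duΦ u⟩

/-- **`DualityThree`** (the one-line route-vocabulary signature of `g9/bc/RouteVocab.lean`, verbatim): `[Δ₃, q·ω₀ω₁ω₁] ≡ [Δ₃, q·ω₀ω₀ω₁]`
— ONE change of variables by the order-reversing involution of `Δ₃`. [Kontsevich–Zagier 2001 §1.2 rule (2)] -/
theorem dualityThree : ∀ (q : ℚ) (s z : Literature.NumberTheory.Transcendental.KZ.IntegralRep 3), s.domain = {t | (∀ i, 0 < t i) ∧ (∀ i, t i < 1) ∧ StrictAnti t} → Set.EqOn s.integrand (fun t => (q : ℝ) * ∏ i, if (![false, true, true] : Fin 3 → Bool) i then 1 / (1 - t i) else 1 / t i) s.domain → z.domain = {t | (∀ i, 0 < t i) ∧ (∀ i, t i < 1) ∧ StrictAnti t} → Set.EqOn z.integrand (fun t => (q : ℝ) / (t 0 * t 1 * (1 - t 2))) z.domain → Literature.NumberTheory.Transcendental.KZ.of s - Literature.NumberTheory.Transcendental.KZ.of z ∈ Literature.NumberTheory.Transcendental.KZ.relations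 := by
  intro q s z hd hi hdz hiz
  have hd' : s.domain = KZ.openOrderedSimplex 3 := hd
  have hdz' : z.domain = KZ.openOrderedSimplex 3 := hdz
  have hΔ := KZ.isSemialgebraic_openOrderedSimplex 3
  have hΦsa : IsSemialgebraicMapOn ℚ s.domain duΦ := by
    rw [hd']
    exact (isSemialgebraicMapOn_aeval hΔ ![MvPolynomial.C 1 - MvPolynomial.X 2,
      MvPolynomial.C 1 - MvPolynomial.X 1, MvPolynomial.C 1 - MvPolynomial.X 0]).congr fun z _ => by
        funext j
        fin_cases j <;> simp [duΦ_zero, duΦ_one, duΦ_two]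
  have hder : ∀ x ∈ s.domain, HasFDerivWithinAt duΦ duL s.domain x := by
    intro x _
    have h : HasFDerivAt (fun z : Fin 3 → ℝ => (fun _ => (1 : ℝ)) + duL z) duL x :=
      (duL.hasFDerivAt).const_add _
    have e : duΦ = fun z : Fin 3 → ℝ => (fun _ => (1 : ℝ)) + duL z := funext duΦ_eq
    rw [e]
    exact h.hasFDerivWithinAt
  have hinj : InjOn duΦ s.domain := fun a _ b _ h => by
    have := congrArg duΦ h
    rwa [duΦ_duΦ, duΦ_duΦ] at this
  have hdom : z.domain = duΦ '' s.domain := by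
    rw [hd', hdz', image_duΦ]
  refine KZ.changeOfVariablesRel_subset_relations ⟨3, s, z, duΦ, fun _ => duL, hΦsa, hder, hinj, hdom,
    fun x hx => ?_, rfl⟩
  have hx' : x ∈ KZ.openOrderedSimplex 3 := by rw [← hd']; exact hx
  have hΦx : duΦ x ∈ z.domain := by rw [hdz']; exact mem_simplex_three_duΦ hx'
  obtain ⟨h2, h21, h10, h0⟩ := (mem_simplex_three_iff x).1 hx'
  show s.integrand x = z.integrand (duΦ x) * |duL.det|
  rw [hi hx, hiz hΦx, abs_det_duL, mul_one]
  show (q : ℝ) * ∏ i : Fin 3, (if (![false, true, true] : Fin 3 → Bool) i then 1 / (1 - x i) else 1 / x i) =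
    (q : ℝ) / (duΦ x 0 * duΦ x 1 * (1 - duΦ x 2))
  rw [duΦ_zero, duΦ_one, duΦ_two, sub_sub_cancel]
  simp only [Fin.prod_univ_three, div_eq_mul_inv, mul_inv]
  rw [if_neg (by decide : ¬ (![false, true, true] : Fin 3 → Bool) 0 = true),
    if_pos (by decide : (![false, true, true] : Fin 3 → Bool) 1 = true),
    if_pos (by decide : (![false, true, true] : Fin 3 → Bool) 2 = true)]
  ring

end Summit.KontsevichZagierPeriods.KontsevichZagierPeriods.Theorems.RootDecompZetaThreeFrontierWordMoves
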